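import Mathlib

/-!
# Oriented SDPP gadgets: the merge normal form and the twisted product (solo-blind seat, s59)

Conventions as in `SoloBlindSdppGadget.lean`: an oriented gadget in an abelian group `G` is a
family of pairs `(P s, Q s)`, `s : ι` linearly ordered, with a set `D` such that
`Q s − P s ⊆ D` (own), `(Q s − P s') ∩ D = ∅` for `s < s'` (cross) and every pair has the
double product property (DPP).  Its *value* only depends on the products `|P s| * |Q s|`.

## Lemma M (merge normal form)
If `i₀` is the least index and `0 ∈ Q i₀` (a free normalisation: the `Q`'s and `D` may be
translated together), replacing the bottom pair by `(P i₀ − Q i₀, {0})` gives again an oriented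
gadget with the same `D` (`soloMerge_own/cross/dpp`) and `|P i₀ − Q i₀| = |P i₀| * |Q i₀|`
(`soloMerge_card`), so the value is unchanged.  Hence in every value / threshold computation one
may assume `|Q_bottom| = |P_top| = 1` (the top is symmetric), which makes the seat's s58 normal form
fully general.

## Lemma T (twisted product)
Let `H ⊆ G` be a finite subgroup (a finite set containing `0`, closed under subtraction), let
`(P i, Q i)_i`, `D_H` be an oriented gadget *inside `H`*, and let `S ⊆ G ∖ H` meet every coset of
`H` at most once.  Index the new family by `Bool ×ₗ ι` (all `false`-pairs first):
`(false, i) ↦ (P i − S, Q i)`, `(true, i) ↦ (P i, Q i + S)`, with `D := D_H + S`.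
This is an oriented gadget of `G` (`soloTwist_own/cross/dpp`) whose pair sizes are those of the
inner gadget multiplied by `|S|` on one side (`soloTwist_card_P/Q`).  With `|S| = [G:H] − 1` its
value is `2 (t−1)^θ · V_inner(θ)`: the extremal ratio satisfies `ρ(G) ≥ ρ_two-pair(t) · ρ(H)`, and
along a subgroup chain every product of two-pair (CKSU 2005, Prop. 24-type) values is realised in
every abelian group of the right order.  `SoloBlindSdppPuncturedSubgroup.lean` is the case where
the inner gadget is the two-pair gadget of `H`.
-/

namespace Summit.MatrixMultiplication.MatrixMultiplication.Theorems

open Finset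

variable {G : Type*} [AddCommGroup G] [DecidableEq G]
variable {ι : Type*} [LinearOrder ι]

/-! ### Lemma M: merging the bottom pair -/

/-- Merged left sets: `P i₀ − Q i₀` at the bottom index, unchanged elsewhere. -/
def soloMergeP (P Q : ι → Finset G) (i₀ : ι) (i : ι) : Finset G :=
  if i = i₀ then ((P i₀) ×ˢ (Q i₀)).image (fun y => y.1 - y.2) else P i

/-- Merged right sets: `{0}` at the bottom index, unchanged elsewhere. -/
def soloMergeQ (Q : ι → Finset G) (i₀ : ι) (i : ι) : Finset G :=
  if i = i₀ then {0} else Q i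

/-- Lemma M, own differences. -/
theorem soloMerge_own (P Q : ι → Finset G) (D : Finset G) (i₀ : ι)
    (hown : ∀ s, ∀ p ∈ P s, ∀ q ∈ Q s, q - p ∈ D) :
    ∀ s, ∀ p ∈ soloMergeP P Q i₀ s, ∀ q ∈ soloMergeQ Q i₀ s, q - p ∈ D := by
  intro s p hp q hq
  by_cases hs : s = i₀
  · subst hs
    simp only [soloMergeP, soloMergeQ, if_true] at hp hq
    obtain ⟨y, hy, rfl⟩ := Finset.mem_image.1 hp
    rw [Finset.mem_product] at hy
    rw [Finset.mem_singleton] at hq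
    subst hq
    simpa using hown s y.1 hy.1 y.2 hy.2
  · simp only [soloMergeP, soloMergeQ, hs, if_false] at hp hq
    exact hown s p hp q hq

/-- Lemma M, cross differences (needs `i₀` least and `0 ∈ Q i₀`). -/
theorem soloMerge_cross (P Q : ι → Finset G) (D : Finset G) (i₀ : ι)
    (hmin : ∀ j, i₀ ≤ j) (h0 : (0 : G) ∈ Q i₀)
    (hcross : ∀ s s', s < s' → ∀ p ∈ P s', ∀ q ∈ Q s, q - p ∉ D) :
    ∀ s s', s < s' → ∀ p ∈ soloMergeP P Q i₀ s', ∀ q ∈ soloMergeQ Q i₀ s, q - p ∉ D := by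
  intro s s' hss' p hp q hq
  have hs' : s' ≠ i₀ := by
    intro h
    subst h
    exact absurd hss' (not_lt.2 (hmin s))
  simp only [soloMergeP, hs', if_false] at hp
  by_cases hs : s = i₀
  · subst hs
    simp only [soloMergeQ, if_true] at hq
    rw [Finset.mem_singleton] at hq
    subst hq
    exact hcross s s' hss' p hp 0 h0
  · simp only [soloMergeQ, hs, if_false] at hq
    exact hcross s s' hss' p hp q hq

/-- Lemma M, double product property. -/
theorem soloMerge_dpp (P Q : ι → Finset G) (i₀ : ι)
    (hdpp : ∀ s, ∀ p ∈ P s, ∀ p' ∈ P s, ∀ q ∈ Q s, ∀ q' ∈ Q s,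
      q - p = q' - p' → p = p' ∧ q = q') :
    ∀ s, ∀ p ∈ soloMergeP P Q i₀ s, ∀ p' ∈ soloMergeP P Q i₀ s,
      ∀ q ∈ soloMergeQ Q i₀ s, ∀ q' ∈ soloMergeQ Q i₀ s, q - p = q' - p' → p = p' ∧ q = q' := by
  intro s p hp p' hp' q hq q' hq' hpq
  by_cases hs : s = i₀
  · subst hs
    simp only [soloMergeQ, if_true] at hq hq'
    rw [Finset.mem_singleton] at hq hq'
    subst hq
    subst hq'
    exact ⟨by simpa using hpq, rfl⟩
  · simp only [soloMergeP, soloMergeQ, hs, if_false] at hp hp' hq hq'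
    exact hdpp s p hp p' hp' q hq q' hq' hpq

/-- Lemma M, the merged bottom pair keeps the product of sizes: `|P i₀ − Q i₀| = |P i₀| * |Q i₀|`
(by the DPP of the old bottom pair), and `|{0}| = 1`. -/
theorem soloMerge_card (P Q : ι → Finset G) (i₀ : ι)
    (hdpp : ∀ s, ∀ p ∈ P s, ∀ p' ∈ P s, ∀ q ∈ Q s, ∀ q' ∈ Q s,
      q - p = q' - p' → p = p' ∧ q = q') :
    (soloMergeP P Q i₀ i₀).card * (soloMergeQ Q i₀ i₀).card = (P i₀).card * (Q i₀).card := by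
  simp only [soloMergeP, soloMergeQ, if_true, Finset.card_singleton, mul_one]
  rw [← Finset.card_product]
  refine Finset.card_image_of_injOn ?_
  intro x hx y hy hxy
  rw [Finset.coe_product, Set.mem_prod] at hx hy
  beta_reduce at hxy
  have e : x.2 - x.1 = y.2 - y.1 := by
    have : x.2 - x.1 = -(x.1 - x.2) := by abel
    rw [this, hxy]
    abel
  obtain ⟨h1, h2⟩ := hdpp i₀ x.1 hx.1 y.1 hy.1 x.2 hx.2 y.2 hy.2 e
  exact Prod.ext h1 h2

/-! ### Lemma T: the twisted product with the two-pair gadget of `G/H` -/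

/-- Twisted left sets: `P i − S` on the `false` block, `P i` on the `true` block. -/
def soloTwistP (S : Finset G) (P : ι → Finset G) (x : Bool ×ₗ ι) : Finset G :=
  if (ofLex x).1 = true then P (ofLex x).2
  else ((P (ofLex x).2) ×ˢ S).image (fun y => y.1 - y.2)

/-- Twisted right sets: `Q i` on the `false` block, `Q i + S` on the `true` block. -/
def soloTwistQ (S : Finset G) (Q : ι → Finset G) (x : Bool ×ₗ ι) : Finset G :=
  if (ofLex x).1 = true then ((Q (ofLex x).2) ×ˢ S).image (fun y => y.1 + y.2)
  else Q (ofLex x).2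

/-- Twisted difference set `D_H + S`. -/
def soloTwistD (S DH : Finset G) : Finset G := (DH ×ˢ S).image (fun y => y.1 + y.2)

section twist

variable {H S DH : Finset G} {P Q : ι → Finset G}

/-- `d + s ∈ D_H + S`. -/
theorem soloTwist_mem_D {d s : G} (hd : d ∈ DH) (hs : s ∈ S) : d + s ∈ soloTwistD S DH :=
  Finset.mem_image.2 ⟨(d, s), Finset.mem_product.2 ⟨hd, hs⟩, rfl⟩

/-- If `y ∈ H` and `y + s ∈ D_H + S` (`D_H ⊆ H`, `S` one element per coset) then `y ∈ D_H`. -/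
theorem soloTwist_mem_DH_of_add_mem
    (hsub : ∀ a ∈ H, ∀ b ∈ H, a - b ∈ H) (hDH : ∀ d ∈ DH, d ∈ H)
    (hS1 : ∀ s ∈ S, ∀ s' ∈ S, s - s' ∈ H → s = s')
    {y s : G} (hy : y ∈ H) (hs : s ∈ S) (hmem : y + s ∈ soloTwistD S DH) : y ∈ DH := by
  obtain ⟨z, hz, hzy⟩ := Finset.mem_image.1 hmem
  rw [Finset.mem_product] at hz
  -- z.1 + z.2 = y + s with z.1 ∈ DH ⊆ H, z.2 ∈ S
  have key : s - z.2 = z.1 - y := by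
    have h1 : s - z.2 = (y + s) - y - z.2 := by abel
    rw [h1, ← hzy]
    abel
  have hss : s = z.2 := hS1 s hs z.2 hz.2 (key ▸ hsub z.1 (hDH z.1 hz.1) y hy)
  have : y = z.1 := by
    have h2 : y = (y + s) - s := by abel
    rw [h2, ← hzy, hss]
    abel
  rw [this]
  exact hz.1

/-- No element of `H` lies in `D_H + S` (as `S ∩ H = ∅`). -/
theorem soloTwist_not_mem_D_of_mem_H
    (hsub : ∀ a ∈ H, ∀ b ∈ H, a - b ∈ H) (hDH : ∀ d ∈ DH, d ∈ H) (hSH : ∀ s ∈ S, s ∉ H)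
    {y : G} (hy : y ∈ H) : y ∉ soloTwistD S DH := by
  intro hmem
  obtain ⟨z, hz, hzy⟩ := Finset.mem_image.1 hmem
  rw [Finset.mem_product] at hz
  apply hSH z.2 hz.2
  have : z.2 = y - z.1 := by rw [← hzy]; abel
  rw [this]
  exact hsub y hy z.1 (hDH z.1 hz.1)

omit [LinearOrder ι] in
/-- Lemma T, own differences. -/
theorem soloTwist_own
    (hown : ∀ i, ∀ p ∈ P i, ∀ q ∈ Q i, q - p ∈ DH) :
    ∀ x, ∀ p ∈ soloTwistP S P x, ∀ q ∈ soloTwistQ S Q x, q - p ∈ soloTwistD S DH := by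
  intro x p hp q hq
  cases hb : (ofLex x).1
  · simp only [soloTwistP, soloTwistQ, hb, Bool.false_eq_true, if_false] at hp hq
    obtain ⟨y, hy, rfl⟩ := Finset.mem_image.1 hp
    rw [Finset.mem_product] at hy
    have := soloTwist_mem_D (hown _ y.1 hy.1 q hq) hy.2 (S := S)
    have e : q - (y.1 - y.2) = q - y.1 + y.2 := by abel
    rw [e]
    exact this
  · simp only [soloTwistP, soloTwistQ, hb, if_true] at hp hq
    obtain ⟨y, hy, rfl⟩ := Finset.mem_image.1 hq
    rw [Finset.mem_product] at hy
    have := soloTwist_mem_D (hown _ p hp y.1 hy.1) hy.2 (S := S)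
    have e : y.1 + y.2 - p = y.1 - p + y.2 := by abel
    rw [e]
    exact this

/-- Lemma T, cross differences. -/
theorem soloTwist_cross
    (hsub : ∀ a ∈ H, ∀ b ∈ H, a - b ∈ H) (hDH : ∀ d ∈ DH, d ∈ H) (hSH : ∀ s ∈ S, s ∉ H)
    (hS1 : ∀ s ∈ S, ∀ s' ∈ S, s - s' ∈ H → s = s')
    (hPH : ∀ i, ∀ p ∈ P i, p ∈ H) (hQH : ∀ i, ∀ q ∈ Q i, q ∈ H)
    (hcross : ∀ i j, i < j → ∀ p ∈ P j, ∀ q ∈ Q i, q - p ∉ DH) :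
    ∀ x y, x < y → ∀ p ∈ soloTwistP S P y, ∀ q ∈ soloTwistQ S Q x,
      q - p ∉ soloTwistD S DH := by
  intro x y hxy p hp q hq
  rw [Prod.Lex.lt_iff] at hxy
  rcases hxy with h1 | ⟨h1, h2⟩
  · -- x in the `false` block, y in the `true` block: the difference lies in H
    obtain ⟨hx, hy⟩ := Bool.lt_iff.1 h1
    simp only [soloTwistP, hy, if_true] at hp
    simp only [soloTwistQ, hx, Bool.false_eq_true, if_false] at hq
    exact soloTwist_not_mem_D_of_mem_H hsub hDH hSH (hsub q (hQH _ q hq) p (hPH _ p hp))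
  · cases hb : (ofLex x).1
    · -- both in the `false` block
      have hb' : (ofLex y).1 = false := h1 ▸ hb
      simp only [soloTwistP, hb', Bool.false_eq_true, if_false] at hp
      simp only [soloTwistQ, hb, Bool.false_eq_true, if_false] at hq
      obtain ⟨z, hz, rfl⟩ := Finset.mem_image.1 hp
      rw [Finset.mem_product] at hz
      intro hmem
      have e : q - (z.1 - z.2) = (q - z.1) + z.2 := by abel
      rw [e] at hmem
      have hin := soloTwist_mem_DH_of_add_mem hsub hDH hS1
        (hsub q (hQH _ q hq) z.1 (hPH _ z.1 hz.1)) hz.2 hmem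
      exact hcross _ _ h2 z.1 hz.1 q hq hin
    · -- both in the `true` block
      have hb' : (ofLex y).1 = true := h1 ▸ hb
      simp only [soloTwistP, hb', if_true] at hp
      simp only [soloTwistQ, hb, if_true] at hq
      obtain ⟨z, hz, rfl⟩ := Finset.mem_image.1 hq
      rw [Finset.mem_product] at hz
      intro hmem
      have e : z.1 + z.2 - p = (z.1 - p) + z.2 := by abel
      rw [e] at hmem
      have hin := soloTwist_mem_DH_of_add_mem hsub hDH hS1
        (hsub z.1 (hQH _ z.1 hz.1) p (hPH _ p hp)) hz.2 hmem
      exact hcross _ _ h2 p hp z.1 hz.1 hin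

omit [LinearOrder ι] in
/-- Lemma T, double product property. -/
theorem soloTwist_dpp
    (hsub : ∀ a ∈ H, ∀ b ∈ H, a - b ∈ H)
    (hS1 : ∀ s ∈ S, ∀ s' ∈ S, s - s' ∈ H → s = s')
    (hPH : ∀ i, ∀ p ∈ P i, p ∈ H) (hQH : ∀ i, ∀ q ∈ Q i, q ∈ H)
    (hdpp : ∀ i, ∀ p ∈ P i, ∀ p' ∈ P i, ∀ q ∈ Q i, ∀ q' ∈ Q i,
      q - p = q' - p' → p = p' ∧ q = q') :
    ∀ x, ∀ p ∈ soloTwistP S P x, ∀ p' ∈ soloTwistP S P x,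
      ∀ q ∈ soloTwistQ S Q x, ∀ q' ∈ soloTwistQ S Q x, q - p = q' - p' → p = p' ∧ q = q' := by
  intro x p hp p' hp' q hq q' hq' hpq
  cases hb : (ofLex x).1
  · simp only [soloTwistP, soloTwistQ, hb, Bool.false_eq_true, if_false] at hp hp' hq hq'
    obtain ⟨z, hz, rfl⟩ := Finset.mem_image.1 hp
    obtain ⟨z', hz', rfl⟩ := Finset.mem_image.1 hp'
    rw [Finset.mem_product] at hz hz'
    -- q - (z.1 - z.2) = q' - (z'.1 - z'.2)
    have key : z.2 - z'.2 = (q' - z'.1) - (q - z.1) := by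
      have h1 : z.2 - z'.2 = (q - (z.1 - z.2)) - q + z.1 - z'.2 := by abel
      rw [h1, hpq]
      abel
    have hzz : z.2 = z'.2 := hS1 z.2 hz.2 z'.2 hz'.2
      (key ▸ hsub _ (hsub q' (hQH _ q' hq') z'.1 (hPH _ z'.1 hz'.1)) _
        (hsub q (hQH _ q hq) z.1 (hPH _ z.1 hz.1)))
    have e : q - z.1 = q' - z'.1 := by
      have h1 : q - z.1 = (q - (z.1 - z.2)) - z.2 := by abel
      rw [h1, hpq, hzz]
      abel
    obtain ⟨h1, h2⟩ := hdpp _ z.1 hz.1 z'.1 hz'.1 q hq q' hq' e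
    refine ⟨?_, h2⟩
    rw [h1, hzz]
  · simp only [soloTwistP, soloTwistQ, hb, if_true] at hp hp' hq hq'
    obtain ⟨z, hz, rfl⟩ := Finset.mem_image.1 hq
    obtain ⟨z', hz', rfl⟩ := Finset.mem_image.1 hq'
    rw [Finset.mem_product] at hz hz'
    -- z.1 + z.2 - p = z'.1 + z'.2 - p'
    have key : z.2 - z'.2 = (z'.1 - p') - (z.1 - p) := by
      have h1 : z.2 - z'.2 = (z.1 + z.2 - p) - z.1 + p - z'.2 := by abel
      rw [h1, hpq]
      abel
    have hzz : z.2 = z'.2 := hS1 z.2 hz.2 z'.2 hz'.2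
      (key ▸ hsub _ (hsub z'.1 (hQH _ z'.1 hz'.1) p' (hPH _ p' hp')) _
        (hsub z.1 (hQH _ z.1 hz.1) p (hPH _ p hp)))
    have e : z.1 - p = z'.1 - p' := by
      have h1 : z.1 - p = (z.1 + z.2 - p) - z.2 := by abel
      rw [h1, hpq, hzz]
      abel
    obtain ⟨h1, h2⟩ := hdpp _ p hp p' hp' z.1 hz.1 z'.1 hz'.1 e
    refine ⟨h1, ?_⟩
    rw [h2, hzz]

/-- Lemma T, sizes: `|P i − S| = |P i| * |S|` (for `P i ⊆ H`). -/
theorem soloTwist_card_sub (hsub : ∀ a ∈ H, ∀ b ∈ H, a - b ∈ H)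
    (hS1 : ∀ s ∈ S, ∀ s' ∈ S, s - s' ∈ H → s = s') (T : Finset G) (hT : ∀ t ∈ T, t ∈ H) :
    ((T ×ˢ S).image (fun y => y.1 - y.2)).card = T.card * S.card := by
  rw [← Finset.card_product]
  refine Finset.card_image_of_injOn ?_
  intro z hz z' hz' hzz
  rw [Finset.coe_product, Set.mem_prod] at hz hz'
  beta_reduce at hzz
  -- z.1 - z.2 = z'.1 - z'.2
  have key : z.2 - z'.2 = z.1 - z'.1 := by
    have h1 : z.2 - z'.2 = z.1 - (z.1 - z.2) - z'.2 := by abel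
    rw [h1, hzz]
    abel
  have h2 : z.2 = z'.2 := hS1 z.2 hz.2 z'.2 hz'.2 (key ▸ hsub z.1 (hT _ hz.1) z'.1 (hT _ hz'.1))
  have h1 : z.1 = z'.1 := by
    have h3 : z.1 = (z.1 - z.2) + z.2 := by abel
    rw [h3, hzz, h2]
    abel
  exact Prod.ext h1 h2

/-- Lemma T, sizes: `|T + S| = |T| * |S|` (for `T ⊆ H`); applies to `Q i + S` and to `D_H + S`. -/
theorem soloTwist_card_add (hsub : ∀ a ∈ H, ∀ b ∈ H, a - b ∈ H)
    (hS1 : ∀ s ∈ S, ∀ s' ∈ S, s - s' ∈ H → s = s') (T : Finset G) (hT : ∀ t ∈ T, t ∈ H) :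
    ((T ×ˢ S).image (fun y => y.1 + y.2)).card = T.card * S.card := by
  rw [← Finset.card_product]
  refine Finset.card_image_of_injOn ?_
  intro z hz z' hz' hzz
  rw [Finset.coe_product, Set.mem_prod] at hz hz'
  beta_reduce at hzz
  -- z.1 + z.2 = z'.1 + z'.2
  have key : z.2 - z'.2 = z'.1 - z.1 := by
    have h1 : z.2 - z'.2 = (z.1 + z.2) - z.1 - z'.2 := by abel
    rw [h1, hzz]
    abel
  have h2 : z.2 = z'.2 := hS1 z.2 hz.2 z'.2 hz'.2 (key ▸ hsub z'.1 (hT _ hz'.1) z.1 (hT _ hz.1))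
  have h1 : z.1 = z'.1 := by
    have h3 : z.1 = (z.1 + z.2) - z.2 := by abel
    rw [h3, hzz, h2]
    abel
  exact Prod.ext h1 h2

omit [LinearOrder ι] in
/-- Lemma T, sizes of the twisted pairs: `|P' x| * |Q' x| = |P i| * |Q i| * |S|` for
`x = (b, i)`. -/
theorem soloTwist_card_pair (hsub : ∀ a ∈ H, ∀ b ∈ H, a - b ∈ H)
    (hS1 : ∀ s ∈ S, ∀ s' ∈ S, s - s' ∈ H → s = s')
    (hPH : ∀ i, ∀ p ∈ P i, p ∈ H) (hQH : ∀ i, ∀ q ∈ Q i, q ∈ H) (x : Bool ×ₗ ι) :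
    (soloTwistP S P x).card * (soloTwistQ S Q x).card =
      (P (ofLex x).2).card * (Q (ofLex x).2).card * S.card := by
  cases hb : (ofLex x).1
  · simp only [soloTwistP, soloTwistQ, hb, Bool.false_eq_true, if_false]
    rw [soloTwist_card_sub hsub hS1 _ (hPH _)]
    ring
  · simp only [soloTwistP, soloTwistQ, hb, if_true]
    rw [soloTwist_card_add hsub hS1 _ (hQH _)]
    ring

end twist

end Summit.MatrixMultiplication.MatrixMultiplication.Theorems
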